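import Summits.ABC.IUTFork.Thm311RealInd1Strip
import Summits.ABC.IUTFork.Thm311RealInd2IsmSignature
import HarnessLib

/-!
# [IUTchIII] Theorem 3.11 (i) (Ind1)+(Ind2), print-literal at `𝕍^non`: the real signature `Real.logShellsPrint` (print's
# strip slot AND print's Ism slot) and the SANDWICH «DH-strip/print-Ism ≤ PRINT ≤ DH» of indeterminacy groups

Record file (D-0012) of the abc-iut cell (seat abc-iut-c312-1, holder of record of the typed [IUTchIII] Thm. 3.11, gen 8);
sequel of `Thm311RealInd1Strip.lean` (print's (Ind1) strip part `Real.ind1StripOf v L` at a finite place) and of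
`Thm311RealInd2IsmSignature.lean` (gen 7: print's (Ind2) slot `Real.ismPrint`, `Real.indGroup_ismPrint_le`).
TAKES NO SIDE on [IUTchIII] Cor. 3.12.

TYPED: `Real.ind1Strip logv v` — print's (Ind1) strip part read on abc-iut-c312-5's carrier `Real.Carrier (inr v)`
(`ℚ`-linear automorphisms whose additive part lies in `Real.ind1StripOf v (logv v)`); `Real.stripPrint logv` — the strip
slot that is `ind1Strip` at the finite places and Dupuy–Hilado's `stripAutDH = {1}` at the infinite ones (the archimedean
strip part — automorphisms of the split monoid `†𝒟⊢_v ∈ Ob(𝕋𝕄⊢)`, [IUTchI] Def. 4.1 (iii) — is NOT typed here);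
**`Real.logShellsPrint X logv`** — c312-5's real `Thm311.LogShells` with PRINT'S strip slot and PRINT'S Ism slot
(`Real.ismPrint`, gen 7) at every finite place.

PROVED: `Real.ind1Strip_subset_ismDH` (every realised strip automorphism is a bicontinuous `φ` with `φ(I_v) = I_v`:
print's (Ind1) strip part, too, ACTS THROUGH Dupuy–Hilado's `Aut_{ℚ_p}(K_v : I_v)`, DH §4.9); `Real.stripAutDH_subset_stripPrint`,
`Real.stripPrint_subset_ismDH`; `Real.Ind1_mono` (monotonicity of (Ind1) in the strip slot), `Real.Ind1_DH_subset_Ind1_print`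
((Ind1) over DH's trivial strip slot `⊆` (Ind1) over print's — the REVERSE of the (Ind2) inclusion of gen 7);
**`Real.ind1Family_print_subset_indGroup_DH`** (an (Ind1)-family over print's strip slot is a capsule permutation COMPOSED
WITH an (Ind2)-family over DH's `Aut_{ℚ_p}(K_v : I_v)` — print's strip automorphisms act summand-wise by lattice
automorphisms); and the SANDWICH **`Real.indGroup_ismPrint_le_print`** / **`Real.indGroup_print_le_DH`**:
`⟨Ind1, Ind2⟩(stripAutDH, ismPrint) ≤ ⟨Ind1, Ind2⟩(stripPrint, ismPrint) ≤ ⟨Ind1, Ind2⟩(stripAutDH, ismDH)` —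
so EVERY `∀`-clause over Dupuy–Hilado's group (log-volume invariance, the typed Thm 3.11 premise) and EVERY hull/orbit
countermodel of record formed over DH's group transfers verbatim to print's full finite-place reading of (Ind1)+(Ind2)
([IUTchIII] Thm. 3.11 (i) p. 154 l. 52–60; Dupuy–Hilado §4.7, §4.9).  What print's reading EXCLUDES relative to DH's
(scalars `≠ 1` in the strip part, lattice shear in the Ism part) is the business of the rigidity sequels
(`Thm311RealInd2IsmRigid/Scalar`, `Thm311RealInd1StripRigid`).
[claim: Mochizuki2012, status: disputed] [cite: DupuyHilado2025, §4.9]. typed ≠ proved; instantiated ≠ endorsed.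
-/

set_option autoImplicit false

noncomputable section

namespace Summit.ABC.IUTFork.Thm311.Real

open NumberField IsDedekindDomain Literature.IUT.LogVolume Literature.IUT.LogThetaLattice

variable {F : Type} [Field F] [NumberField F] (X : PilotData F) (logv : PadicLogs F)

/-! ## 5. On c312-5's real signature: print's (Ind1) strip part `⊆ Real.ismDH` -/

/-- **PRINT'S (Ind1) STRIP PART AT THE FINITE PLACE `v` OF THE REAL SIGNATURE**: `ind1StripOf` for c312-5's log-binder
`logv v`, read on `Real.Carrier (inr v) = v.adicCompletion F` (`ℚ`-linearity is automatic for additive automorphisms in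
characteristic `0`; the slot type asks for it). [claim: Mochizuki2012, status: disputed] -/
def ind1Strip (logv : PadicLogs F) (v : HeightOneSpectrum (𝓞 F)) :
    Set (Carrier (.inr v : Place F) ≃ₗ[ℚ] Carrier (.inr v : Place F)) :=
  {ψ | (ψ.toAddEquiv : v.adicCompletion F ≃+ v.adicCompletion F) ∈ ind1StripOf v (logv v)}

/-- Membership unfolded. [folklore] -/
theorem mem_ind1Strip_iff (v : HeightOneSpectrum (𝓞 F)) (ψ : Carrier (.inr v : Place F) ≃ₗ[ℚ] Carrier (.inr v : Place F)) :
    ψ ∈ ind1Strip logv v ↔ (ψ.toAddEquiv : v.adicCompletion F ≃+ v.adicCompletion F) ∈ ind1StripOf v (logv v) :=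
  Iff.rfl

/-- `1 ∈ Real.ind1Strip logv v`. [folklore] -/
theorem refl_mem_ind1Strip (v : HeightOneSpectrum (𝓞 F)) :
    LinearEquiv.refl ℚ (Carrier (.inr v : Place F)) ∈ ind1Strip logv v :=
  refl_mem_ind1StripOf v (logv v)

/-- **PRINT'S (Ind1) STRIP PART ACTS THROUGH DUPUY–HILADO'S (Ind2)**: `Real.ind1Strip logv v ⊆ Real.ismDH logv (inr v)` —
every automorphism of `K_v` induced by an automorphism of the `𝒟⊢`-prime-strip at `v` is a bicontinuous `ℚ`-linear `φ` with
`φ(I_v) = I_v` (Dupuy–Hilado §4.9 «act through the group `Aut_{ℚ_p}(K_v : I_v)`», as a kernel theorem about the cell's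
typings; DH §4.7 types (Ind1) as capsule permutations only). [cite: DupuyHilado2025, §4.9] [claim: Mochizuki2012, status: disputed] -/
theorem ind1Strip_subset_ismDH (v : HeightOneSpectrum (𝓞 F)) : ind1Strip logv v ⊆ ismDH logv (.inr v : Place F) := by
  intro ψ hψ
  exact ⟨hψ.1, hψ.2.1, image_shell_eq_of_mem_ind1StripOf v (logv v) (residueChar F v) hψ⟩

/-- The strip slot that is print's `ind1Strip` at the finite places and DH's `stripAutDH = {1}` at the infinite places (the
archimedean strip part is not typed in this file). [claim: Mochizuki2012, status: disputed] -/
def stripPrint (logv : PadicLogs F) : ∀ x : Place F, Set (Carrier x ≃ₗ[ℚ] Carrier x)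
  | .inl w => stripAutDH (.inl w)
  | .inr v => ind1Strip logv v

/-- The identity lies in the strip slot at every place. [folklore] -/
theorem refl_mem_stripPrint (x : Place F) : LinearEquiv.refl ℚ (Carrier x) ∈ stripPrint logv x := by
  cases x with
  | inl w => exact refl_mem_stripAutDH (.inl w)
  | inr v => exact refl_mem_ind1Strip logv v

/-- DH's trivialised strip slot lies in print's, place by place. [cite: DupuyHilado2025, §4.7] -/
theorem stripAutDH_subset_stripPrint (x : Place F) : stripAutDH x ⊆ stripPrint logv x := by
  intro φ hφ
  rw [show φ = LinearEquiv.refl ℚ (Carrier x) from hφ]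
  exact refl_mem_stripPrint logv x

/-- **Print's strip slot ⊆ the typed DH (Ind2) slot, place by place.** [cite: DupuyHilado2025, §4.9] -/
theorem stripPrint_subset_ismDH (x : Place F) : stripPrint logv x ⊆ ismDH logv x := by
  cases x with
  | inl w =>
    intro φ hφ
    rw [show φ = LinearEquiv.refl ℚ (Carrier (.inl w : Place F)) from hφ]
    exact refl_mem_ismDH logv (.inl w)
  | inr v => exact ind1Strip_subset_ismDH logv v

/-- **`Thm311.LogShells` with PRINT'S (Ind1) strip slot AND PRINT'S nonarchimedean (Ind2) slot**: c312-5's real signature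
with `stripPrint` and gen 7's `ismPrint`. [claim: Mochizuki2012, status: disputed] -/
def logShellsPrint : LogShells (thetaIndex X) :=
  logShells X logv (stripPrint logv) (ismPrint logv) (refl_mem_stripPrint logv) (refl_mem_ismPrint logv)

/-! ## 6. Monotonicity in the strip slot and the sandwich of indeterminacy groups -/

/-- MONOTONICITY of (Ind1) in the strip slot, for the real signature (same permutations, more strip automorphisms).
[folklore] -/
theorem Ind1_mono {Aut Aut' Ism : ∀ x : Place F, Set (Carrier x ≃ₗ[ℚ] Carrier x)}
    (hA : ∀ x, LinearEquiv.refl ℚ (Carrier x) ∈ Aut x) (hA' : ∀ x, LinearEquiv.refl ℚ (Carrier x) ∈ Aut' x)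
    (hI : ∀ x, LinearEquiv.refl ℚ (Carrier x) ∈ Ism x) (hle : ∀ x, Aut x ⊆ Aut' x) (j : (thetaIndex X).Label) :
    (logShells X logv Aut Ism hA hI).Ind1 j ⊆ (logShells X logv Aut' Ism hA' hI).Ind1 j := by
  rintro Φ ⟨σ, h, hh, hΦ⟩
  exact ⟨σ, h, fun i x => hle _ (hh i x), hΦ⟩

/-- **(Ind1) over DH's trivial strip slot ⊆ (Ind1) over print's strip slot** (with print's Ism slot on both sides) — the
REVERSE direction of the (Ind2) inclusion `Ind2_ismPrint_subset_Ind2_ismDH` of gen 7. [claim: Mochizuki2012, status: disputed] -/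
theorem Ind1_DH_subset_Ind1_print (j : (thetaIndex X).Label) :
    (logShellsIsm X logv).Ind1 j ⊆ (logShellsPrint X logv).Ind1 j :=
  Ind1_mono X logv refl_mem_stripAutDH (refl_mem_stripPrint logv) (refl_mem_ismPrint logv)
    (stripAutDH_subset_stripPrint logv) j

/-- (Ind2) is unchanged by the strip slot (same Ism slot). [folklore] -/
theorem Ind2Family_print_eq :
    (logShellsPrint X logv).Ind2Family = (show Set (logShellsPrint X logv).PacketAut from (logShellsIsm X logv).Ind2Family) :=
  rfl

/-- **`⟨Ind1, Ind2⟩(stripAutDH, ismPrint) ≤ ⟨Ind1, Ind2⟩(stripPrint, ismPrint)`** — the lower half of the sandwich.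
[claim: Mochizuki2012, status: disputed] -/
theorem indGroup_ismPrint_le_print :
    (logShellsIsm X logv).IndGroup ≤ (show Subgroup (logShellsIsm X logv).PacketAut from (logShellsPrint X logv).IndGroup) := by
  change Subgroup.closure _ ≤ Subgroup.closure _
  refine Subgroup.closure_mono ?_
  rintro Φ (hΦ | hΦ)
  · exact Or.inl fun j => Ind1_DH_subset_Ind1_print X logv j (hΦ j)
  · exact Or.inr (by rw [Ind2Family_print_eq]; exact hΦ)

/-- The capsule permutation `σ` alone (all strip automorphisms trivial) is an (Ind1)-automorphism over DH's strip slot.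
[cite: DupuyHilado2025, §4.7] -/
theorem permute_mem_Ind1_DH (j : (thetaIndex X).Label) (σ : Equiv.Perm ((thetaIndex X).Caps j)) :
    (fun vQ => (logShellsDH X logv).permute j vQ σ) ∈ (logShellsDH X logv).Ind1 j := by
  refine ⟨σ, fun _ x => LinearEquiv.refl ℚ _, fun _ x => refl_mem_stripAutDH x, fun vQ => ?_⟩
  rw [LogShells.summandwise_refl_family, LogShells.factorwise_refl, LinearEquiv.trans_refl]

/-- **An (Ind1)-automorphism over PRINT'S strip slot is a capsule permutation COMPOSED WITH an (Ind2)-automorphism over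
DH's slot**: at each `v_ℚ`, `Φ(v_ℚ) = F(v_ℚ) ∘ permute(σ)` with `F(v_ℚ) ∈ Ind2(ismDH)` (print's strip automorphisms at
the finite places lie in `ismDH`, `stripPrint_subset_ismDH`, and act summand-wise, factor-wise — exactly the shape of an
(Ind2)-automorphism). [cite: DupuyHilado2025, §4.9] [claim: Mochizuki2012, status: disputed] -/
theorem exists_Ind2_DH_of_mem_Ind1_print {j : (thetaIndex X).Label}
    {Φ : ∀ vQ, (logShellsPrint X logv).Packet j vQ ≃ₗ[ℚ] (logShellsPrint X logv).Packet j vQ}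
    (hΦ : Φ ∈ (logShellsPrint X logv).Ind1 j) :
    ∃ (σ : Equiv.Perm ((thetaIndex X).Caps j))
      (Ψ : ∀ vQ, (logShellsDH X logv).Packet j vQ ≃ₗ[ℚ] (logShellsDH X logv).Packet j vQ),
      (∀ vQ, Ψ vQ ∈ (logShellsDH X logv).Ind2 j vQ) ∧
      ∀ vQ, Φ vQ = ((logShellsDH X logv).permute j vQ σ).trans (Ψ vQ) := by
  obtain ⟨σ, h, hh, hΦ⟩ := hΦ
  refine ⟨σ, fun vQ => (logShellsDH X logv).factorwise j vQ fun i =>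
      (logShellsDH X logv).summandwise vQ fun x => h i x.1, fun vQ => ?_, fun vQ => hΦ vQ⟩
  exact ⟨fun i x => h i x.1, fun i x => stripPrint_subset_ismDH logv x.1 (hh i x.1), rfl⟩

/-- **An (Ind1)-family over print's strip slot lies in DH's indeterminacy group** (it is the product, in the group of packet
automorphism families, of an (Ind2)-family over `ismDH` and a family of capsule permutations).
[cite: DupuyHilado2025, §4.9] [claim: Mochizuki2012, status: disputed] -/
theorem ind1Family_print_subset_indGroup_DH :
    (logShellsPrint X logv).Ind1Family ⊆
      (show Set (logShellsPrint X logv).PacketAut from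
        ((logShellsDH X logv).IndGroup : Set (logShellsDH X logv).PacketAut)) := by
  intro Φ hΦ
  choose σ Ψ hΨ hΦσ using fun j => exists_Ind2_DH_of_mem_Ind1_print X logv (hΦ j)
  -- `Φ = Ψ * P` with `P` the family of permutations
  let P : (logShellsDH X logv).PacketAut := fun j vQ => (logShellsDH X logv).permute j vQ (σ j)
  have hP : P ∈ (logShellsDH X logv).Ind1Family := fun j => permute_mem_Ind1_DH X logv j (σ j)
  have hΨ' : (fun j vQ => Ψ j vQ) ∈ (logShellsDH X logv).Ind2Family := fun j vQ => hΨ j vQ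
  have hprod : (show (logShellsDH X logv).PacketAut from Φ) = (fun j vQ => Ψ j vQ) * P := by
    funext j vQ
    exact hΦσ j vQ
  change (show (logShellsDH X logv).PacketAut from Φ) ∈ (logShellsDH X logv).IndGroup
  rw [hprod]
  exact (logShellsDH X logv).IndGroup.mul_mem ((logShellsDH X logv).ind2Family_subset_indGroup hΨ')
    ((logShellsDH X logv).ind1Family_subset_indGroup hP)

/-- **THE SANDWICH, upper half: `⟨Ind1, Ind2⟩(stripPrint, ismPrint) ≤ ⟨Ind1, Ind2⟩(stripAutDH, ismDH)`** — print's full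
finite-place reading of (Ind1)+(Ind2), as typed here, ACTS THROUGH Dupuy–Hilado's group: every union of possible images /
holomorphic hull formed over DH's group CONTAINS the one formed over print's (hull operators are monotone), every
`∀`-clause over DH's group restricts, and every countermodel of record whose hull over DH's group is too small for the
(xi-f) licence / `Cor312.Setting.Statement` remains one under print's reading of BOTH indeterminacies at `𝕍^non`.
[cite: DupuyHilado2025, §4.9] [claim: Mochizuki2012, status: disputed] -/
theorem indGroup_print_le_DH :
    (logShellsPrint X logv).IndGroup ≤ (show Subgroup (logShellsPrint X logv).PacketAut from (logShellsDH X logv).IndGroup) := by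
  change Subgroup.closure _ ≤ _
  rw [Subgroup.closure_le]
  rintro Φ (hΦ | hΦ)
  · exact ind1Family_print_subset_indGroup_DH X logv hΦ
  · rw [Ind2Family_print_eq] at hΦ
    exact (logShellsDH X logv).ind2Family_subset_indGroup (Ind2Family_ismPrint_subset X logv hΦ)

/-- The two halves together with gen 7's `indGroup_ismPrint_le`: all three typed indeterminacy groups lie in DH's.
[cite: DupuyHilado2025, §4.9] [claim: Mochizuki2012, status: disputed] -/
theorem indGroup_ismPrint_le_print_le_DH :
    (logShellsIsm X logv).IndGroup ≤ (show Subgroup (logShellsIsm X logv).PacketAut from (logShellsPrint X logv).IndGroup) ∧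
      (logShellsPrint X logv).IndGroup ≤
        (show Subgroup (logShellsPrint X logv).PacketAut from (logShellsDH X logv).IndGroup) :=
  ⟨indGroup_ismPrint_le_print X logv, indGroup_print_le_DH X logv⟩

end Summit.ABC.IUTFork.Thm311.Real

end
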